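import Summits.AtomisticToContinuum.Crystallization.Theorems.ThreeConeCertificateOnePercentCertificateFccRung

/-!
# `OnePercentCertificate` (stmt-AtomisticToContinuum-11958) — certified window `0.7175` (fcc, computational)

Supports file of the line `Sketch` (continuation lead c3).  It sharpens the certified rung of
`…OnePercentCertificateFccRung.lean` (`0.711`, twenty explicit shells of `D₃`, kernel `decide`) to
`7175/10000`, i.e. to within `10⁻⁴` of the believed optimum `−e(hcp) = 0.71760` (`−e(fcc) = 0.71753`):

* `sumBox_le` — the Lennard-Jones lattice sum of `(a/√2)·D₃`, `a² = 943/1000` (nearest-neighbour distance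
  `a ≈ 0.97108`, the optimum is `0.9712`), over the `456 336` non-zero vectors of even coordinate sum in the box
  `[−48, 48]³` is `≤ −1.4350` — an exact rational inequality (numerator and denominator have `≈ 7 000` digits)
  evaluated by `native_decide` (computational certificate; axiom `Lean.ofReduceBool` on top of the whitelist);
* `energyPerParticle_fccPC_aW_le` — hence **`e(fcc, a) ≤ −0.7175`**: every other term of the lattice sum is `≤ 0`
  (all non-zero lattice vectors have norm `≥ a` and `a⁶ ≥ 1/2`), exactly as in the `0.711` rung (numerically `e(fcc, a) = −0.717507`, limit of the full sum `−0.71752`);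
* `eStar_le` — `e* ≤ −0.7175` for the periodic infimum `e*` (tree: `eStar`; previous certified `−0.711`);
* `not_threeConeCertificate_of_lt` / `threeCone_noCertificate_below_07175` — **no three-cone certificate of ANY
  range has value `b < 0.7175`** (periodic tightness: certificate ⇒ `E(N)/N ≥ −b`, trial states ⇒
  `E(N)/N ≤ e(fcc,a) + ε`).  With the crux's `29/40 = 0.725` this certifies that `OnePercentCertificate` asks for a
  certificate within `0.0075` per particle (`1.05 %`) of the best possible three-cone value — the "one percent" of
  its name is now a tree fact, not a numerical remark.

All `[folklore]`.
-/

namespace Summit.AtomisticToContinuum.Crystallization.Theorems.OnePercentFccWindow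

-- Elaborating hypotheses `t ∈ boxW` makes Lean unfold the concrete box (`Finset.range 97`, products) to weak
-- head normal form in a few bookkeeping places; the default recursion depth `512` is too small for that.
set_option maxRecDepth 16384

open scoped BigOperators
open Literature.MathematicalPhysics.StatisticalMechanics
open Literature.Geometry.DiscreteGeometry (intVec sqNormInt intVec_injective)
open Summit.AtomisticToContinuum.Crystallization.Theorems
open Summit.AtomisticToContinuum.Crystallization.Theorems.LayeredLawsSelectHcp.Negative.IntegerForms
  (norm_smul_intVec intVec_zero)
open Summit.AtomisticToContinuum.Crystallization.Theorems.LayeredLawsSelectHcp.Negative.FccLattice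
  (cs cs_pos cs_sq fccD3 le_dist_of_mem_fccD3)
open Summit.AtomisticToContinuum.Crystallization.Theorems.LayeredLawsSelectHcp.Negative.FccEnergy
  (fccPC energyPerParticle_fccPC summable_abs_lennardJones_fccD3 eStar_le_energyPerParticle_fccPC)
open Summit.AtomisticToContinuum.Crystallization.Theorems.ChargedEnergyGapNegative (eStar)
open Summit.AtomisticToContinuum.Crystallization.Theorems.OnePercentFccRung
  (lennardJones_nonpos_of_half_le lennardJones_norm_smul_intVec)
open Filter

/-! ## The computational certificate (exact rational arithmetic) -/

/-- Side of the box of integer vectors, `[−48, 48]³` indexed by `{0,…,96}³`. [folklore] -/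
def nW : ℕ := 97

/-- Box index to integer coordinate, `n ↦ n − 48`. [folklore] -/
def crd (n : ℕ) : ℤ := (n : ℤ) - 48

/-- The non-zero integer vectors of even coordinate sum in the box `[−48, 48]³`, as index triples
(`(48,48,48)` is the origin; `i + j + k ≡ (i−48) + (j−48) + (k−48) (mod 2)`). [folklore] -/
def boxW : Finset (ℕ × ℕ × ℕ) :=
  ((Finset.range nW) ×ˢ ((Finset.range nW) ×ˢ (Finset.range nW))).filter
    fun t => t ≠ (48, 48, 48) ∧ (t.1 + t.2.1 + t.2.2) % 2 = 0

/-- Membership in the box (stated once, outside any `classical` context). [folklore] -/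
theorem mem_boxW {t : ℕ × ℕ × ℕ} :
    t ∈ boxW ↔ t ∈ (Finset.range nW) ×ˢ ((Finset.range nW) ×ˢ (Finset.range nW)) ∧
      (t ≠ (48, 48, 48) ∧ (t.1 + t.2.1 + t.2.2) % 2 = 0) := by
  rw [boxW, Finset.mem_filter]

/-- Squared integer norm of the vector with index triple `t`. [folklore] -/
def sqN (t : ℕ × ℕ × ℕ) : ℤ := crd t.1 ^ 2 + crd t.2.1 ^ 2 + crd t.2.2 ^ 2

/-- The value of `V_LJ` at the lattice vector of squared integer norm `m`, scale `(cs a)² = 943/2000`, as a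
rational: `φ(m) = (1/12)(943 m/2000)⁻⁶ − (1/6)(943 m/2000)⁻³`. [folklore] -/
def phiQ (m : ℤ) : ℚ :=
  1 / 12 * (((943 : ℚ) / 2000 * m)⁻¹) ^ 6 - 1 / 6 * (((943 : ℚ) / 2000 * m)⁻¹) ^ 3

/-- The box lattice sum as a rational number. [folklore] -/
def sumBoxQ : ℚ := ∑ t ∈ boxW, phiQ (sqN t)

/-- **The certificate**: the box lattice sum is `≤ −1.4350` (exact rational comparison of a `456 336`-term sum,
run by compiled evaluation). [folklore] -/
theorem sumBoxQ_le : sumBoxQ ≤ -(14350 / 10000) := by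
  native_decide

/-! ## The scale `a = √(943/1000)` and the box vectors as lattice points -/

/-- The nearest-neighbour distance of the test lattice, `a = √0.943 ≈ 0.97108`. [folklore] -/
noncomputable def aW : ℝ := Real.sqrt (943 / 1000)

/-- `a > 0`. [folklore] -/
theorem aW_pos : 0 < aW := Real.sqrt_pos.2 (by norm_num)

/-- `a² = 943/1000`. [folklore] -/
theorem aW_sq : aW ^ 2 = 943 / 1000 := Real.sq_sqrt (by norm_num)

/-- `a ≠ 0`. [folklore] -/
theorem aW_ne_zero : aW ≠ 0 := aW_pos.ne'

/-- Parity of a box index triple. [folklore] -/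
theorem parity_of_mem_boxW {t : ℕ × ℕ × ℕ} (ht : t ∈ boxW) : (t.1 + t.2.1 + t.2.2) % 2 = 0 :=
  (mem_boxW.1 ht).2.2

/-- A box index triple is not the centre. [folklore] -/
theorem ne_of_mem_boxW {t : ℕ × ℕ × ℕ} (ht : t ∈ boxW) : t ≠ (48, 48, 48) :=
  (mem_boxW.1 ht).2.1

/-- `crd` is injective. [folklore] -/
theorem crd_injective : Function.Injective crd := by
  intro m n h
  unfold crd at h
  omega

/-- Index triples as integer vectors. [folklore] -/
def toVec (t : ℕ × ℕ × ℕ) : Fin 3 → ℤ := ![crd t.1, crd t.2.1, crd t.2.2]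

/-- Components of `toVec`. [folklore] -/
theorem toVec_apply (t : ℕ × ℕ × ℕ) :
    toVec t 0 = crd t.1 ∧ toVec t 1 = crd t.2.1 ∧ toVec t 2 = crd t.2.2 := ⟨rfl, rfl, rfl⟩

/-- `toVec` is injective. [folklore] -/
theorem toVec_injective : Function.Injective toVec := by
  intro s t h
  have h0 : crd s.1 = crd t.1 := by rw [← (toVec_apply s).1, ← (toVec_apply t).1, h]
  have h1 : crd s.2.1 = crd t.2.1 := by rw [← (toVec_apply s).2.1, ← (toVec_apply t).2.1, h]
  have h2 : crd s.2.2 = crd t.2.2 := by rw [← (toVec_apply s).2.2, ← (toVec_apply t).2.2, h]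
  exact Prod.ext (crd_injective h0) (Prod.ext (crd_injective h1) (crd_injective h2))

/-- Squared norm of `toVec t`. [folklore] -/
theorem sqNormInt_toVec (t : ℕ × ℕ × ℕ) : sqNormInt (toVec t) = sqN t := by
  rw [sqNormInt, (toVec_apply t).1, (toVec_apply t).2.1, (toVec_apply t).2.2, sqN]

/-- A vector of the box has even coordinate sum. [folklore] -/
theorem even_toVec {t : ℕ × ℕ × ℕ} (ht : (t.1 + t.2.1 + t.2.2) % 2 = 0) :
    Even (toVec t 0 + toVec t 1 + toVec t 2) := by
  rw [(toVec_apply t).1, (toVec_apply t).2.1, (toVec_apply t).2.2, Int.even_iff]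
  unfold crd
  omega

/-- A vector of the box other than the centre index is non-zero. [folklore] -/
theorem toVec_ne_zero {t : ℕ × ℕ × ℕ} (ht : t ≠ (48, 48, 48)) : toVec t ≠ 0 := by
  intro h
  apply ht
  have h0 : crd t.1 = 0 := by rw [← (toVec_apply t).1, h]; rfl
  have h1 : crd t.2.1 = 0 := by rw [← (toVec_apply t).2.1, h]; rfl
  have h2 : crd t.2.2 = 0 := by rw [← (toVec_apply t).2.2, h]; rfl
  unfold crd at h0 h1 h2
  refine Prod.ext ?_ (Prod.ext ?_ ?_) <;> simp only <;> omega

/-- The lattice point of `(a/√2)·D₃` with index triple `t`. [folklore] -/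
noncomputable def gW (t : ℕ × ℕ × ℕ) : EuclideanSpace ℝ (Fin 3) := cs aW • intVec (toVec t)

/-- `gW` is injective. [folklore] -/
theorem gW_injective : Function.Injective gW :=
  ((smul_right_injective (EuclideanSpace ℝ (Fin 3)) (cs_pos aW_pos).ne').comp intVec_injective).comp
    toVec_injective

/-- Every box vector is a non-zero point of the lattice `fccD3 a`. [folklore] -/
theorem gW_mem {t : ℕ × ℕ × ℕ} (ht : t ∈ boxW) : gW t ∈ (fccD3 aW : Set (EuclideanSpace ℝ (Fin 3))) ∧ gW t ≠ 0 := by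
  refine ⟨⟨toVec t, even_toVec (parity_of_mem_boxW ht), rfl⟩, ?_⟩
  intro h0
  have hi : intVec (toVec t) = 0 := by
    rcases smul_eq_zero.1 h0 with h | h
    · exact absurd h (cs_pos aW_pos).ne'
    · exact h
  exact toVec_ne_zero (ne_of_mem_boxW ht) (intVec_injective (by rw [hi, intVec_zero]))

/-- The real lattice term at `t` equals the rational `φ` at its squared norm. [folklore] -/
theorem lennardJones_gW (t : ℕ × ℕ × ℕ) : lennardJones ‖gW t‖ = (phiQ (sqN t) : ℝ) := by
  rw [gW, lennardJones_norm_smul_intVec, sqNormInt_toVec, cs_sq, aW_sq, phiQ]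
  push_cast
  ring_nf

/-- The real box sum equals the rational certificate value. [folklore] -/
theorem sum_box_eq : ∑ t ∈ boxW, lennardJones ‖gW t‖ = (sumBoxQ : ℝ) := by
  rw [sumBoxQ, Rat.cast_sum]
  exact Finset.sum_congr rfl fun t _ => lennardJones_gW t

/-- **The box sum is `≤ −1.4350`** over `ℝ`. [folklore] -/
theorem sum_box_le : ∑ t ∈ boxW, lennardJones ‖gW t‖ ≤ -(14350 / 10000) := by
  rw [sum_box_eq]
  have h' : ((sumBoxQ : ℚ) : ℝ) ≤ ((-(14350 / 10000) : ℚ) : ℝ) := Rat.cast_le.2 sumBoxQ_le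
  simpa using h'

/-! ## The certified bound and the rung -/

/-- **`e(fcc at nearest-neighbour distance √0.943) ≤ −0.7175`.** [folklore] -/
theorem energyPerParticle_fccPC_aW_le :
    (fccPC aW_ne_zero).energyPerParticle lennardJones ≤ -(7175 / 10000) := by
  rw [energyPerParticle_fccPC]
  set T := {y : EuclideanSpace ℝ (Fin 3) // y ∈ (fccD3 aW : Set (EuclideanSpace ℝ (Fin 3))) ∧ y ≠ 0}
  set f : T → ℝ := fun y => lennardJones ‖(y : EuclideanSpace ℝ (Fin 3))‖ with hf
  have hsum : Summable f := (summable_abs_lennardJones_fccD3 aW_ne_zero).of_abs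
  -- every term is `≤ 0`
  have hnonpos : ∀ y : T, f y ≤ 0 := fun y => by
    have h1 : aW ≤ ‖(y : EuclideanSpace ℝ (Fin 3))‖ := by
      have := le_dist_of_mem_fccD3 aW_pos y.2.1 (fccD3 aW).zero_mem y.2.2
      rwa [dist_zero_right] at this
    have hpos : 0 < ‖(y : EuclideanSpace ℝ (Fin 3))‖ := aW_pos.trans_le h1
    refine lennardJones_nonpos_of_half_le hpos ?_
    calc (1 / 2 : ℝ) ≤ aW ^ 6 := by
          rw [show aW ^ 6 = (aW ^ 2) ^ 3 by ring, aW_sq]; norm_num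
      _ ≤ ‖(y : EuclideanSpace ℝ (Fin 3))‖ ^ 6 := pow_le_pow_left₀ aW_pos.le h1 6
  -- the box vectors, as a finset of `T` (an embedded copy of `boxW`)
  let e : {t // t ∈ boxW} ↪ T :=
    ⟨fun t => ⟨gW t.1, gW_mem t.2⟩, fun s t h =>
      Subtype.ext (gW_injective (congrArg (fun y : T => (y : EuclideanSpace ℝ (Fin 3))) h))⟩
  let S : Finset T := boxW.attach.map e
  have hS : ∑ y ∈ S, f y = ∑ t ∈ boxW, lennardJones ‖gW t‖ := by
    rw [Finset.sum_map, ← Finset.sum_attach boxW]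
    exact Finset.sum_congr rfl fun t _ => rfl
  have hval : ∑ t ∈ boxW, lennardJones ‖gW t‖ ≤ -(14350 / 10000) := sum_box_le
  have hsplit := hsum.sum_add_tsum_compl (s := S)
  have htail : ∑' y : ↥((↑S : Set T)ᶜ), f y ≤ 0 := tsum_nonpos fun y => hnonpos y
  have htot : ∑' y : T, f y ≤ -(14350 / 10000) := by
    rw [← hsplit, hS]; linarith
  linarith

/-- **`e* ≤ −0.7175`** for the infimum `e* = inf_Q e(Q)` of the Lennard-Jones energy per particle over
periodic configurations of `ℝ³` (tree: `eStar`; previous certified bound `−0.711`). [folklore] -/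
theorem eStar_le : eStar ≤ -(7175 / 10000) :=
  (eStar_le_energyPerParticle_fccPC aW_ne_zero).trans energyPerParticle_fccPC_aW_le

/-- **Certified window `0.7175`.** No three-cone certificate (of any range `ρ`) has value `b < 7175/10000`:
the certificate gives `E(N)/N ≥ −(c + f 0/2)` for `N ≥ 1`, the proved trial-state bound gives
`E(N)/N ≤ e(fcc_a) + ε` eventually, and `e(fcc_a) ≤ −0.7175`. [folklore] -/
theorem not_threeConeCertificate_of_lt {b ρ : ℝ} (hb : b < 7175 / 10000) :
    ¬ ∃ (c : ℝ) (g U f : ℝ → ℝ), (∀ r : ℝ, 0 < r → lennardJones r = g r + U r + f r) ∧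
      (∀ r : ℝ, 0 < r → 0 ≤ U r) ∧ (∀ r : ℝ, ρ ≤ r → g r = 0) ∧
      (∀ (n : ℕ) (y : Fin n → EuclideanSpace ℝ (Fin 3)) (w : Fin n → ℝ),
        0 ≤ ∑ i, ∑ j, w i * w j * f (dist (y i) (y j))) ∧
      (∀ (N : ℕ) (x : Fin N → EuclideanSpace ℝ (Fin 3)), Function.Injective x →
        -(c * (N : ℝ)) ≤ interactionEnergy g x) ∧
      c + f 0 / 2 ≤ b := by
  rintro ⟨c, g, U, f, hdec, hU, -, hpos, hstab, hval⟩
  have hlow : ∀ N : ℕ, 1 ≤ N → -(c + f 0 / 2) ≤ groundStateEnergy lennardJones 3 N / N := by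
    intro N hN
    refine le_groundStateEnergy_div_of_forall_le hN fun x hx => ?_
    have h := onePercentCertificate_value_lower_bound hdec hU hpos hstab hx
    linarith
  have hT := trialStateUpper_proof
  unfold Summit.AtomisticToContinuum.Crystallization.Theses.ThreeConeCertificate.TrialStateUpper at hT
  have hle : -(c + f 0 / 2) ≤ (fccPC aW_ne_zero).energyPerParticle lennardJones := by
    refine le_of_forall_pos_le_add fun ε hε => ?_
    obtain ⟨N, hN₁, hN₂⟩ := ((hT (fccPC aW_ne_zero) ε hε).and (eventually_ge_atTop 1)).exists
    exact (hlow N hN₂).trans hN₁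
  have hfcc := energyPerParticle_fccPC_aW_le
  linarith

/-- **The crux's slack is at most `0.0075` per particle (certified).** The value `29/40` of
`OnePercentCertificate` exceeds the certified impossible values `b < 0.7175` by at most `29/40 − 7175/10000 = 3/400`,
i.e. the crux asks for a three-cone certificate within `1.05 %` of the best possible value. [folklore] -/
theorem onePercentCertificate_slack : (29 / 40 : ℝ) - 7175 / 10000 = 3 / 400 := by norm_num

/-- **Rung** (crux item stmt-AtomisticToContinuum-11958, by-product): for every bound `b < 7175/10000` and every
range `ρ`, there is no three-cone certificate of value `≤ b`. [folklore] -/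
theorem threeCone_noCertificate_below_07175 : ∀ (b ρ : ℝ), b < 7175 / 10000 → ¬ ∃ (c : ℝ) (g U f : ℝ → ℝ), (∀ r : ℝ, 0 < r → lennardJones r = g r + U r + f r) ∧ (∀ r : ℝ, 0 < r → 0 ≤ U r) ∧ (∀ r : ℝ, ρ ≤ r → g r = 0) ∧ (∀ (n : ℕ) (y : Fin n → EuclideanSpace ℝ (Fin 3)) (w : Fin n → ℝ), 0 ≤ ∑ i, ∑ j, w i * w j * f (dist (y i) (y j))) ∧ (∀ (N : ℕ) (x : Fin N → EuclideanSpace ℝ (Fin 3)), Function.Injective x → -(c * (N : ℝ)) ≤ interactionEnergy g x) ∧ c + f 0 / 2 ≤ b :=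
  fun _ _ hb => not_threeConeCertificate_of_lt hb

end Summit.AtomisticToContinuum.Crystallization.Theorems.OnePercentFccWindow
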